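import Summits.CriticalPhenomena.PercolationContinuityZ3.Theses.PercNearOneGluing
import Summits.CriticalPhenomena.PercolationContinuityZ3.Theorems.PercNearOneGluingAdditiveGluingSpectatorEdgeBHK
import Literature.Probability.Percolation.TwoClusterExchange
import HarnessLib

/-!
# Crux `PercNearOneGluing.AdditiveGluing` (stmt-CriticalPhenomena-4576), line `tieline`: the K₀ attachment transfer
# (registered stub `stub_k0AttachTransfer_c9`)

Support file (`--supports stmt-CriticalPhenomena-4576`, lead c9).  No definitions, no named facts, no sorries.

Weighted graph on a finite vertex type (`μ = prodBernoulli w`), pair `{u, v}`, observer `o`, spectator `c`.  Write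
`J = {o ↔ c}`, `N_c = {c ↮ u} ∩ {c ↮ v}`, `D' = {c ↮ u}`.

**Attachment transfer (`stub_k0AttachTransfer_c9`).**
`μ({u ↮ v} ∩ {v ↔ c}) · μ(N_c ∩ J) ≤ μ({u ↮ v} ∩ {v ↔ o}) · μ(N_c)`.

Proof.  `{u ↮ v} ∩ {v ↔ c} = D' ∩ B'` with `B' = {c ↔ v} ∩ {u ↮ v}` (if `u ↮ v` and `v ↔ c` then `c ↮ u`), and
`D' ∩ J ∩ B' ⊆ {u ↮ v} ∩ {v ↔ o}` (`v ↔ c ↔ o`).  So it suffices to show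
`μ(D' ∩ B') · μ(N_c ∩ J) ≤ μ(D' ∩ J ∩ B') · μ(N_c)`, which is the product of two van den Berg–Häggström–Kahn
inequalities for the two clusters `(C_c, C_u)` given `D' = {c ↮ u}` (Thm. 1.5: "on `{s ↮ t}` the variables
`1{e ∈ C_s}`, `1{e ∉ C_t}` are positively associated"), in the event ("exchange") form landed in
`Literature/Probability/Percolation/TwoClusterExchange.lean`:
* (A) `μ(D' ∩ J) · μ(D' ∩ B') ≤ μ(D' ∩ J ∩ B') · μ(D')` — `J = {c ↔ o}`, `{c ↔ v}` and `{u ↮ v}` are all of type `(+)`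
  (closed under enlarging `C_c` and shrinking `C_u`), hence positively correlated given `D'`;
* (B) `μ(N_c ∩ J) · μ(D') ≤ μ(D' ∩ J) · μ(N_c)` — `J` (type `(+)`) and `{c ↮ v}` (type `(−)`) are negatively
  correlated given `D'`, and `N_c = D' ∩ {c ↮ v}`.
Multiplying (A)·(B) and cancelling `μ(D') · μ(D' ∩ J)` (the cases `μ(D') = 0`, `μ(D' ∩ J) = 0` are trivial) gives the
claim; `c = u` is degenerate (`D' = ∅`).
[cite: VandenbergHaggstromKahn2005, Thm. 1.3 (p. 6), Thm. 1.5 (p. 7)]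
[cite: KozmaNitzan2024, §2.2 (p. 5), the BHK inequalities for two clusters]
-/

namespace Summit.CriticalPhenomena.PercolationContinuityZ3.Cruxes.AdditiveGluing.TieLine

open MeasureTheory Set Literature.Probability.LatticeModels Literature.Probability.Percolation
open Summit.CriticalPhenomena.PercolationContinuityZ3.Theorems

noncomputable section

namespace K0AttachTransfer

variable {V : Type*} [Fintype V]

/-- **(A)** BHK Thm. 1.5 for `(C_c, C_u)` given `D' = {c ↮ u}` (`c ≠ u`): `J = {c ↔ o}` and `B' = {c ↔ v} ∩ {u ↮ v}`
(both of type `(+)`) are positively correlated: `μ(D' ∩ J) · μ(D' ∩ B') ≤ μ(D' ∩ (J ∩ B')) · μ(D')`.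
[cite: VandenbergHaggstromKahn2005, Thm. 1.5 (p. 7)] -/
theorem bhk_linkA (w : Sym2 V → unitInterval) (o u v c : V) (hcu : c ≠ u) :
    (prodBernoulli w).real ((openConn c u)ᶜ ∩ openConn c o) *
        (prodBernoulli w).real ((openConn c u)ᶜ ∩ (openConn c v ∩ (openConn u v)ᶜ)) ≤
      (prodBernoulli w).real ((openConn c u)ᶜ ∩ (openConn c o ∩ (openConn c v ∩ (openConn u v)ᶜ))) *
        (prodBernoulli w).real ((openConn c u)ᶜ : Set (BondConfig V)) := by
  have key := twoClusterExchange w hcu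
    (A₁ := openConn c o) (A₂ := openConn c v ∩ (openConn u v)ᶜ) (B₁ := univ) (B₂ := univ)
    (typePlus_openConn c u o)
    (fun _ _ h1 h2 hω => ⟨typePlus_openConn c u v h1 h2 hω.1, typePlus_not_openConn c u v h1 h2 hω.2⟩)
    (fun _ _ _ _ _ => mem_univ _) (fun _ _ _ _ _ => mem_univ _)
  simpa only [inter_univ, univ_inter] using key

/-- **(B)** BHK Thm. 1.5 for `(C_c, C_u)` given `D' = {c ↮ u}` (`c ≠ u`): `J = {c ↔ o}` (type `(+)`) and `{c ↮ v}`
(type `(−)`) are negatively correlated: `μ(D' ∩ (J ∩ {c ↮ v})) · μ(D') ≤ μ(D' ∩ J) · μ(D' ∩ {c ↮ v})`, i.e.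
`P(J | c ↮ u, c ↮ v) ≤ P(J | c ↮ u)` (BHK Thm. 1.3 with `X = {u}`, upper event `J`, lower event `{c ↮ v}`).
[cite: VandenbergHaggstromKahn2005, Thm. 1.3 (p. 6), Thm. 1.5 (p. 7)] -/
theorem bhk_linkB (w : Sym2 V → unitInterval) (o u v c : V) (hcu : c ≠ u) :
    (prodBernoulli w).real ((openConn c u)ᶜ ∩ (openConn c o ∩ (openConn c v)ᶜ)) *
        (prodBernoulli w).real ((openConn c u)ᶜ : Set (BondConfig V)) ≤
      (prodBernoulli w).real ((openConn c u)ᶜ ∩ openConn c o) *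
        (prodBernoulli w).real ((openConn c u)ᶜ ∩ (openConn c v)ᶜ) := by
  have key := twoClusterExchange w hcu
    (A₁ := openConn c o) (A₂ := univ) (B₁ := (openConn c v)ᶜ) (B₂ := univ)
    (typePlus_openConn c u o) (fun _ _ _ _ _ => mem_univ _)
    (typeMinus_not_openConn c u v) (fun _ _ _ _ _ => mem_univ _)
  simpa only [inter_univ, univ_inter] using key

/-- **Chain (A)·(B)** (one measure, any weights, `c ≠ u`): with `D' = {c ↮ u}`, `B' = {c ↔ v} ∩ {u ↮ v}`, `J = {c ↔ o}`,
`N_c = D' ∩ {c ↮ v}`: `μ(D' ∩ B') · μ(N_c ∩ J) ≤ μ(D' ∩ (J ∩ B')) · μ(N_c)` — division-free form of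
`P(J | D' ∩ B') ≥ P(J | D') ≥ P(J | N_c)`.
[cite: VandenbergHaggstromKahn2005, Thm. 1.3 (p. 6), Thm. 1.5 (p. 7)] -/
theorem chain (w : Sym2 V → unitInterval) (o u v c : V) (hcu : c ≠ u) :
    (prodBernoulli w).real ((openConn c u)ᶜ ∩ (openConn c v ∩ (openConn u v)ᶜ)) *
        (prodBernoulli w).real ((openConn c u)ᶜ ∩ (openConn c o ∩ (openConn c v)ᶜ)) ≤
      (prodBernoulli w).real ((openConn c u)ᶜ ∩ (openConn c o ∩ (openConn c v ∩ (openConn u v)ᶜ))) *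
        (prodBernoulli w).real ((openConn c u)ᶜ ∩ (openConn c v)ᶜ : Set (BondConfig V)) := by
  have hA := bhk_linkA w o u v c hcu
  have hB := bhk_linkB w o u v c hcu
  set μ := prodBernoulli w with hμ
  set y := μ.real ((openConn c u)ᶜ ∩ (openConn c v ∩ (openConn u v)ᶜ)) with hy
  set nj := μ.real ((openConn c u)ᶜ ∩ (openConn c o ∩ (openConn c v)ᶜ)) with hnj
  set x := μ.real ((openConn c u)ᶜ ∩ (openConn c o ∩ (openConn c v ∩ (openConn u v)ᶜ))) with hx
  set nn := μ.real ((openConn c u)ᶜ ∩ (openConn c v)ᶜ : Set (BondConfig V)) with hnn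
  set m := μ.real ((openConn c u)ᶜ : Set (BondConfig V)) with hm
  set j := μ.real ((openConn c u)ᶜ ∩ openConn c o) with hj
  -- hA : j * y ≤ x * m,  hB : nj * m ≤ j * nn
  have hy0 : 0 ≤ y := measureReal_nonneg
  have hnj0 : 0 ≤ nj := measureReal_nonneg
  have hx0 : 0 ≤ x := measureReal_nonneg
  have hnn0 : 0 ≤ nn := measureReal_nonneg
  have hm0 : 0 ≤ m := measureReal_nonneg
  have hj0 : 0 ≤ j := measureReal_nonneg
  have hy_le : y ≤ m := measureReal_mono inter_subset_left
  have hnj_le : nj ≤ j := measureReal_mono (inter_subset_inter_right _ inter_subset_left)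
  by_cases hmz : m = 0
  · have hy' : y = 0 := le_antisymm (hy_le.trans hmz.le) hy0
    rw [hy', zero_mul]
    exact mul_nonneg hx0 hnn0
  by_cases hjz : j = 0
  · have hnj' : nj = 0 := le_antisymm (hnj_le.trans hjz.le) hnj0
    rw [hnj', mul_zero]
    exact mul_nonneg hx0 hnn0
  have hmpos : 0 < m := lt_of_le_of_ne hm0 (Ne.symm hmz)
  have hjpos : 0 < j := lt_of_le_of_ne hj0 (Ne.symm hjz)
  have h : y * nj * (j * m) ≤ x * nn * (j * m) :=
    calc y * nj * (j * m) = (j * y) * (nj * m) := by ring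
      _ ≤ (x * m) * (j * nn) := mul_le_mul hA hB (mul_nonneg hnj0 hm0) (mul_nonneg hx0 hm0)
      _ = x * nn * (j * m) := by ring
  exact le_of_mul_le_mul_right h (mul_pos hjpos hmpos)

end K0AttachTransfer

namespace K0AttachTransfer

variable {n : ℕ}

/-- `{u ↮ v} ∩ {v ↔ c} = {c ↮ u} ∩ ({c ↔ v} ∩ {u ↮ v})`: if `u ↮ v` and `v ↔ c` then `c ↮ u`. [folklore] -/
theorem attach_eq (u v c : Fin n) :
    ((openConn u v)ᶜ ∩ openConn v c : Set (BondConfig (Fin n))) =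
      (openConn c u)ᶜ ∩ (openConn c v ∩ (openConn u v)ᶜ) := by
  ext ω
  simp only [mem_inter_iff, mem_compl_iff, openConn, mem_setOf_eq]
  constructor
  · rintro ⟨huv, hvc⟩
    exact ⟨fun hcu => huv (hvc.trans hcu).symm, hvc.symm, huv⟩
  · rintro ⟨-, hcv, huv⟩
    exact ⟨huv, hcv.symm⟩

/-- `N_c ∩ {o ↔ c} = {c ↮ u} ∩ ({c ↔ o} ∩ {c ↮ v})`. [folklore] -/
theorem slack_inter_eq (o u v c : Fin n) :
    ((openConn c u)ᶜ ∩ (openConn c v)ᶜ ∩ openConn o c : Set (BondConfig (Fin n))) =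
      (openConn c u)ᶜ ∩ (openConn c o ∩ (openConn c v)ᶜ) := by
  rw [KNPreFKG.openConn_symm o c, inter_assoc, inter_comm ((openConn c v)ᶜ)]

/-- `{c ↮ u} ∩ {c ↔ o} ∩ {c ↔ v} ∩ {u ↮ v} ⊆ {u ↮ v} ∩ {v ↔ o}` (`v ↔ c ↔ o`). [folklore] -/
theorem attach_obs_subset (o u v c : Fin n) :
    ((openConn c u)ᶜ ∩ (openConn c o ∩ (openConn c v ∩ (openConn u v)ᶜ)) : Set (BondConfig (Fin n))) ⊆
      (openConn u v)ᶜ ∩ openConn v o := by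
  intro ω hω
  simp only [mem_inter_iff, mem_compl_iff, openConn, mem_setOf_eq] at hω ⊢
  obtain ⟨-, hco, hcv, huv⟩ := hω
  exact ⟨huv, hcv.symm.trans hco⟩

end K0AttachTransfer

open K0AttachTransfer in
/-- **Registered stub `stub_k0AttachTransfer_c9`** (K₀ attachment transfer; line `tieline`, crux `AdditiveGluing`): with
`J = {o ↔ c}`, `N_c = {c ↮ u} ∩ {c ↮ v}`:  `μ({u↮v} ∩ {v↔c}) · μ(N_c ∩ J) ≤ μ({u↮v} ∩ {v↔o}) · μ(N_c)`.
Two vdBHK inequalities for `(C_c, C_u)` given `{c ↮ u}` (`K0AttachTransfer.chain`) plus the inclusion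
`{c↮u} ∩ J ∩ {c↔v} ∩ {u↮v} ⊆ {u↮v} ∩ {v↔o}`; `c = u` is degenerate (`{c ↮ c} = ∅`).
[cite: VandenbergHaggstromKahn2005, Thm. 1.3 (p. 6), Thm. 1.5 (p. 7)] [cite: KozmaNitzan2024, §2.2 (p. 5)] -/
theorem stub_k0AttachTransfer_c9 : ∀ (n : ℕ) (w : Sym2 (Fin n) → unitInterval) (o u v c : Fin n), (Literature.Probability.LatticeModels.prodBernoulli w).real ((Literature.Probability.Percolation.openConn u v)ᶜ ∩ Literature.Probability.Percolation.openConn v c : Set (Literature.Probability.Percolation.BondConfig (Fin n))) * (Literature.Probability.LatticeModels.prodBernoulli w).real ((Literature.Probability.Percolation.openConn c u)ᶜ ∩ (Literature.Probability.Percolation.openConn c v)ᶜ ∩ Literature.Probability.Percolation.openConn o c : Set (Literature.Probability.Percolation.BondConfig (Fin n))) ≤ (Literature.Probability.LatticeModels.prodBernoulli w).real ((Literature.Probability.Percolation.openConn u v)ᶜ ∩ Literature.Probability.Percolation.openConn v o : Set (Literature.Probability.Percolation.BondConfig (Fin n))) * (Literature.Probability.LatticeModels.prodBernoulli w).real ((Literature.Probability.Percolation.openConn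 c u)ᶜ ∩ (Literature.Probability.Percolation.openConn c v)ᶜ : Set (Literature.Probability.Percolation.BondConfig (Fin n))) := by
  intro n w o u v c
  by_cases hcu : c = u
  · subst hcu
    simp only [SpectatorEdgeBHK.compl_openConn_self, empty_inter, measureReal_empty, mul_zero, le_refl]
  rw [attach_eq u v c, slack_inter_eq o u v c]
  calc (prodBernoulli w).real ((openConn c u)ᶜ ∩ (openConn c v ∩ (openConn u v)ᶜ)) *
        (prodBernoulli w).real ((openConn c u)ᶜ ∩ (openConn c o ∩ (openConn c v)ᶜ))
      ≤ (prodBernoulli w).real ((openConn c u)ᶜ ∩ (openConn c o ∩ (openConn c v ∩ (openConn u v)ᶜ))) *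
        (prodBernoulli w).real ((openConn c u)ᶜ ∩ (openConn c v)ᶜ : Set (BondConfig (Fin n))) :=
        chain w o u v c hcu
    _ ≤ (prodBernoulli w).real ((openConn u v)ᶜ ∩ openConn v o) *
        (prodBernoulli w).real ((openConn c u)ᶜ ∩ (openConn c v)ᶜ : Set (BondConfig (Fin n))) :=
        mul_le_mul_of_nonneg_right (measureReal_mono (attach_obs_subset o u v c)) measureReal_nonneg

end

end Summit.CriticalPhenomena.PercolationContinuityZ3.Cruxes.AdditiveGluing.TieLine
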